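import Mathlib
import HarnessLib
import Literature.NumberTheory.GaloisRepresentations.AdequacyOrthogonalDegreeThree

/-!
# Cayley–Hamilton for `SU(3)`: `U³ − t U² + t̄ U − 1 = 0`, `U† = U² − t U + t̄·1`, `tr U² = t² − 2t̄`; for traceless `Q`, `Q³ = ½tr(Q²) Q + det Q` and `exp Q` is a quadratic polynomial in `Q`

HONEST FRAMING: exact (Metropolis-corrected) sampling algorithms for lattice gauge theory;
figures of merit are autocorrelation/cost numbers at stated couplings and volumes; no
continuum-physics claim.

Venture `LatticeQCDFlow` (cell pub-lqcd), sub-topic `Scoring`; FANOUT row 21 (`su3-base`: the 4D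
`SU(3)` baselines).  NEW WORK of the cell (placement rule), elementary; no definition is introduced;
nothing is cited as a fact; no number of ours.  The `3 × 3` Cayley–Hamilton identity in adjugate form
is REUSED from the tree (`Literature/NumberTheory/GaloisRepresentations/AdequacyOrthogonalDegreeThree`,
`OrthogonalDegreeThree.cayleyHamilton_fin_three` — the same statement, imported, not restated).  Printed counterparts NAMED ONLY: the
Cayley–Hamilton exponentiation of `su(3)` matrices of Morningstar–Peardon, Phys. Rev. D 69 (2004)
054501, §III (`e^{iQ} = f₀ + f₁ Q + f₂ Q²`), used by every `SU(3)` code for the HMC link update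
`U ← exp(ε P) U`, the Wilson-flow step and stout smearing; the `SU(3)` inverse-as-a-polynomial
`U⁻¹ = U² − (tr U) U + conj(tr U)·1`.

The `3 × 3` Cayley–Hamilton theorem in invariant form reads `A³ − e₁ A² + e₂ A − e₃ = 0` with
`e₁ = tr A`, `e₂ = tr (adj A)` (the sum of the principal `2 × 2` minors), `e₃ = det A`.  For
`U ∈ SU(3)` the adjugate IS the inverse, `adj U = U† `, so `e₂ = conj (tr U)`: the characteristic
polynomial of an `SU(3)` matrix is `λ³ − t λ² + t̄ λ − 1`, determined by the single complex number
`t = tr U`.  For a TRACELESS `Q` (e.g. `Q ∈ su(3)`, or `i` times a traceless Hermitian matrix),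
`e₂ = −½ tr(Q²)`, so `Q³ = ½ tr(Q²) Q + det Q · 1`; every power of `Q`, and hence the exponential
series, lies in the three-dimensional space spanned by `1, Q, Q²`.

## What is proved

* §1 (any commutative ring, `3 × 3`; the tree's `cayleyHamilton_fin_three` is
  `A³ − (tr A)•A² + (tr adj A)•A − (det A)•1 = 0`) `trace_sq_fin_three`
  (`tr A² = (tr A)² − 2 tr adj A`), `trace_pow_three_fin_three`
  (`tr A³ = (tr A)³ − 3 (tr A)(tr adj A) + 3 det A`).
* §2 (`SU(n)` / `SU(3)`) `adjugate_eq_star_of_mem_specialUnitaryGroup` (`adj U = U†` on `SU(n)`),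
  `trace_adjugate_eq_conj_trace` (`tr adj U = conj tr U`), **`su3_cayleyHamilton`**
  (`U³ − t•U² + t̄•U − 1 = 0`), **`su3_star_eq_polynomial`** (`U† = U² − t•U + t̄•1`),
  `su3_trace_sq` (`tr U² = t² − 2 t̄`), `su3_trace_pow_three` (`tr U³ = t³ − 3 t t̄ + 3`).
* §3 (traceless `3 × 3` complex matrices) **`pow_three_eq_of_trace_eq_zero`**
  (`Q³ = (½ tr Q²)•Q + (det Q)•1`), `exists_pow_eq_of_trace_eq_zero` / `pow_mem_span_of_trace_eq_zero`
  (every `Qⁿ` is `a•1 + b•Q + c•Q²`), **`exp_mem_span_of_trace_eq_zero`** and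
  **`exists_exp_eq_of_trace_eq_zero`**: `NormedSpace.exp Q = f₀•1 + f₁•Q + f₂•Q²` for some
  `f₀, f₁, f₂ ∈ ℂ` (the span is finite-dimensional, hence closed, and contains every partial sum of
  the exponential series).

NOT CLAIMED: the Morningstar–Peardon closed forms of `f₀, f₁, f₂` in terms of the eigenvalue
invariants (their eqs. (29)–(33)) or their numerical conditioning; anything for `N ≠ 3`.
-/

namespace Summit.Ventures.LatticeQCDFlow.Scoring

open Matrix
open Literature.NumberTheory.GaloisRepresentations.OrthogonalDegreeThree (cayleyHamilton_fin_three)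

/-! ## §1 Traces of `A²`, `A³` for `3 × 3` matrices (Cayley–Hamilton in adjugate form is the tree's `cayleyHamilton_fin_three`) -/

section AnyRing

variable {R : Type*} [CommRing R]

/-- `tr A² = (tr A)² − 2 tr adj A` for `3 × 3` matrices. -/
theorem trace_sq_fin_three (A : Matrix (Fin 3) (Fin 3) R) :
    (A ^ 2).trace = A.trace ^ 2 - 2 * (adjugate A).trace := by
  simp [pow_two, Matrix.mul_apply, Fin.sum_univ_three, adjugate_fin_three, trace_fin_three]
  ring

/-- `tr A³ = (tr A)³ − 3 (tr A)(tr adj A) + 3 det A` for `3 × 3` matrices (Newton's identity). -/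
theorem trace_pow_three_fin_three (A : Matrix (Fin 3) (Fin 3) R) :
    (A ^ 3).trace = A.trace ^ 3 - 3 * A.trace * (adjugate A).trace + 3 * A.det := by
  simp [pow_succ, Matrix.mul_apply, Fin.sum_univ_three, adjugate_fin_three, det_fin_three,
    trace_fin_three]
  ring

end AnyRing

/-! ## §2 `SU(3)`: the adjugate is the inverse, so the characteristic polynomial is `λ³ − tλ² + t̄λ − 1` -/

section SpecialUnitary

variable {n : Type*} [Fintype n] [DecidableEq n]

/-- On `SU(n)` the adjugate is the conjugate transpose: `adj U = det(U)·U⁻¹ = U†`. -/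
theorem adjugate_eq_star_of_mem_specialUnitaryGroup {U : Matrix n n ℂ}
    (hU : U ∈ Matrix.specialUnitaryGroup n ℂ) : adjugate U = star U := by
  have h1 : U * adjugate U = 1 := by
    rw [mul_adjugate, (Matrix.mem_specialUnitaryGroup_iff.mp hU).2, one_smul]
  have h2 : star U * U = 1 := Unitary.star_mul_self_of_mem (Matrix.mem_specialUnitaryGroup_iff.mp hU).1
  calc adjugate U = (star U * U) * adjugate U := by rw [h2, Matrix.one_mul]
    _ = star U * (U * adjugate U) := by rw [Matrix.mul_assoc]
    _ = star U := by rw [h1, Matrix.mul_one]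

/-- Hence `tr adj U = conj (tr U)` on `SU(n)`. -/
theorem trace_adjugate_eq_conj_trace {U : Matrix n n ℂ} (hU : U ∈ Matrix.specialUnitaryGroup n ℂ) :
    (adjugate U).trace = (starRingEnd ℂ) U.trace := by
  rw [adjugate_eq_star_of_mem_specialUnitaryGroup hU, star_eq_conjTranspose, trace_conjTranspose,
    Complex.star_def]

/-- **Cayley–Hamilton for `SU(3)`**: `U³ − t U² + t̄ U − 1 = 0` with `t = tr U`. -/
theorem su3_cayleyHamilton {U : Matrix (Fin 3) (Fin 3) ℂ}
    (hU : U ∈ Matrix.specialUnitaryGroup (Fin 3) ℂ) :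
    U ^ 3 - U.trace • U ^ 2 + ((starRingEnd ℂ) U.trace) • U - (1 : Matrix (Fin 3) (Fin 3) ℂ) = 0 := by
  have h := cayleyHamilton_fin_three U
  rwa [trace_adjugate_eq_conj_trace hU, (Matrix.mem_specialUnitaryGroup_iff.mp hU).2, one_smul] at h

/-- **The `SU(3)` inverse is a quadratic polynomial**: `U† = U⁻¹ = U² − t U + t̄·1`, `t = tr U`. -/
theorem su3_star_eq_polynomial {U : Matrix (Fin 3) (Fin 3) ℂ}
    (hU : U ∈ Matrix.specialUnitaryGroup (Fin 3) ℂ) :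
    star U = U ^ 2 - U.trace • U + ((starRingEnd ℂ) U.trace) • (1 : Matrix (Fin 3) (Fin 3) ℂ) := by
  set P : Matrix (Fin 3) (Fin 3) ℂ :=
    U ^ 2 - U.trace • U + ((starRingEnd ℂ) U.trace) • (1 : Matrix (Fin 3) (Fin 3) ℂ) with hP
  have hUP : U * P = 1 := by
    have h := su3_cayleyHamilton hU
    rw [sub_eq_zero] at h
    calc U * P = U ^ 3 - U.trace • U ^ 2 + ((starRingEnd ℂ) U.trace) • U := by
          rw [hP, Matrix.mul_add, Matrix.mul_sub, Matrix.mul_smul, Matrix.mul_smul, Matrix.mul_one,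
            pow_succ' U 2, sq]
      _ = 1 := h
  have h2 : star U * U = 1 := Unitary.star_mul_self_of_mem (Matrix.mem_specialUnitaryGroup_iff.mp hU).1
  calc star U = star U * (U * P) := by rw [hUP, Matrix.mul_one]
    _ = (star U * U) * P := by rw [Matrix.mul_assoc]
    _ = P := by rw [h2, Matrix.one_mul]

/-- `tr U² = t² − 2 t̄` on `SU(3)` (the doubly-wound loop in terms of the singly-wound one). -/
theorem su3_trace_sq {U : Matrix (Fin 3) (Fin 3) ℂ} (hU : U ∈ Matrix.specialUnitaryGroup (Fin 3) ℂ) :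
    (U ^ 2).trace = U.trace ^ 2 - 2 * (starRingEnd ℂ) U.trace := by
  rw [trace_sq_fin_three, trace_adjugate_eq_conj_trace hU]

/-- `tr U³ = t³ − 3 t t̄ + 3` on `SU(3)`. -/
theorem su3_trace_pow_three {U : Matrix (Fin 3) (Fin 3) ℂ}
    (hU : U ∈ Matrix.specialUnitaryGroup (Fin 3) ℂ) :
    (U ^ 3).trace = U.trace ^ 3 - 3 * U.trace * (starRingEnd ℂ) U.trace + 3 := by
  rw [trace_pow_three_fin_three, trace_adjugate_eq_conj_trace hU,
    (Matrix.mem_specialUnitaryGroup_iff.mp hU).2, mul_one]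

end SpecialUnitary

/-! ## §3 Traceless `3 × 3` matrices: `Q³ = ½ tr(Q²) Q + det Q`, and the exponential is quadratic in `Q` -/

section Traceless

/-- **`Q³ = ½ tr(Q²)·Q + det Q·1`** for every traceless `3 × 3` complex matrix (Cayley–Hamilton with
`e₁ = 0`, `e₂ = −½ tr Q²`). -/
theorem pow_three_eq_of_trace_eq_zero (Q : Matrix (Fin 3) (Fin 3) ℂ) (hQ : Q.trace = 0) :
    Q ^ 3 = ((1 / 2 : ℂ) * (Q ^ 2).trace) • Q + Q.det • (1 : Matrix (Fin 3) (Fin 3) ℂ) := by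
  have h := cayleyHamilton_fin_three Q
  have h2 := trace_sq_fin_three Q
  rw [hQ, zero_smul, sub_zero] at h
  rw [hQ, zero_pow two_ne_zero, zero_sub] at h2
  have hadj : (adjugate Q).trace = -((1 / 2 : ℂ) * (Q ^ 2).trace) := by
    rw [h2]; ring
  rw [hadj, neg_smul, ← sub_eq_add_neg] at h
  -- `h : Q³ − (½ tr Q²)•Q − det•1 = 0`
  rw [sub_sub, sub_eq_zero] at h
  exact h

/-- Every power of a traceless `3 × 3` matrix is a combination of `1, Q, Q²` (explicit recursion on
the coefficients: `(a, b, c) ↦ (c det Q, a + c·½tr Q², b)`). -/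
theorem exists_pow_eq_of_trace_eq_zero (Q : Matrix (Fin 3) (Fin 3) ℂ) (hQ : Q.trace = 0) (n : ℕ) :
    ∃ a b c : ℂ, Q ^ n = a • (1 : Matrix (Fin 3) (Fin 3) ℂ) + b • Q + c • Q ^ 2 := by
  induction n with
  | zero => exact ⟨1, 0, 0, by simp⟩
  | succ k ih =>
    obtain ⟨a, b, c, hk⟩ := ih
    have h3 := pow_three_eq_of_trace_eq_zero Q hQ
    refine ⟨c * Q.det, a + c * ((1 / 2 : ℂ) * (Q ^ 2).trace), b, ?_⟩
    calc Q ^ (k + 1) = Q ^ k * Q := pow_succ Q k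
      _ = a • Q + b • Q ^ 2 + c • Q ^ 3 := by
          rw [hk, Matrix.add_mul, Matrix.add_mul, Matrix.smul_mul, Matrix.smul_mul, Matrix.smul_mul,
            Matrix.one_mul, pow_succ Q 2, sq]
      _ = (c * Q.det) • (1 : Matrix (Fin 3) (Fin 3) ℂ) + (a + c * ((1 / 2 : ℂ) * (Q ^ 2).trace)) • Q
            + b • Q ^ 2 := by
          rw [h3, smul_add, smul_smul, smul_smul, add_smul]
          abel

/-- Every power of a traceless `3 × 3` matrix lies in `span {1, Q, Q²}`. -/
theorem pow_mem_span_of_trace_eq_zero (Q : Matrix (Fin 3) (Fin 3) ℂ) (hQ : Q.trace = 0) (n : ℕ) :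
    Q ^ n ∈ Submodule.span ℂ ({1, Q, Q ^ 2} : Set (Matrix (Fin 3) (Fin 3) ℂ)) := by
  obtain ⟨a, b, c, h⟩ := exists_pow_eq_of_trace_eq_zero Q hQ n
  rw [h]
  exact Submodule.mem_span_triple.mpr ⟨a, b, c, rfl⟩

/-- **The exponential of a traceless `3 × 3` matrix lies in `span {1, Q, Q²}`** (Morningstar–Peardon's
starting point): the span is finite-dimensional, hence closed, and every partial sum of the
exponential series lies in it. -/
theorem exp_mem_span_of_trace_eq_zero (Q : Matrix (Fin 3) (Fin 3) ℂ) (hQ : Q.trace = 0) :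
    NormedSpace.exp Q ∈ Submodule.span ℂ ({1, Q, Q ^ 2} : Set (Matrix (Fin 3) (Fin 3) ℂ)) := by
  set K : Submodule ℂ (Matrix (Fin 3) (Fin 3) ℂ) :=
    Submodule.span ℂ ({1, Q, Q ^ 2} : Set (Matrix (Fin 3) (Fin 3) ℂ)) with hK
  have hKc : IsClosed (K : Set (Matrix (Fin 3) (Fin 3) ℂ)) := K.closed_of_finiteDimensional
  rw [NormedSpace.exp_eq_tsum ℂ]
  change (∑' k : ℕ, ((Nat.factorial k : ℂ)⁻¹) • Q ^ k) ∈ K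
  by_cases hs : Summable fun k : ℕ => ((Nat.factorial k : ℂ)⁻¹) • Q ^ k
  · refine hKc.mem_of_tendsto hs.hasSum (Filter.Eventually.of_forall fun s => ?_)
    exact K.sum_mem fun k _ => K.smul_mem _ (pow_mem_span_of_trace_eq_zero Q hQ k)
  · rw [tsum_eq_zero_of_not_summable hs]
    exact K.zero_mem

/-- **`exp Q = f₀·1 + f₁·Q + f₂·Q²`** for some complex `f₀, f₁, f₂`, for every traceless `3 × 3`
complex matrix `Q` (in particular for `Q = ε P`, `P ∈ su(3)`, the HMC / flow link update). -/
theorem exists_exp_eq_of_trace_eq_zero (Q : Matrix (Fin 3) (Fin 3) ℂ) (hQ : Q.trace = 0) :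
    ∃ f₀ f₁ f₂ : ℂ, NormedSpace.exp Q = f₀ • (1 : Matrix (Fin 3) (Fin 3) ℂ) + f₁ • Q + f₂ • Q ^ 2 := by
  obtain ⟨a, b, c, h⟩ := Submodule.mem_span_triple.mp (exp_mem_span_of_trace_eq_zero Q hQ)
  exact ⟨a, b, c, h.symm⟩

end Traceless

end Summit.Ventures.LatticeQCDFlow.Scoring
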